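import Summits.BirchSwinnertonDyer.BirchSwinnertonDyer.Theorems.KimAtThreeDeepLowerOffStratumLevelLoweringDoubleStabRows
import Summits.BirchSwinnertonDyer.BirchSwinnertonDyer.Theorems.KimAtThreeDeepLowerOffStratumLevelLoweringMultiStabData
import Summits.BirchSwinnertonDyer.BirchSwinnertonDyer.Theorems.KimAtThreeDeepLowerOffStratumLevelLoweringMultiStabIhara
import HarnessLib

/-!
# Route `KimAtThreeKolyvagin` (rung W2), crux `DeepLowerAtThreeOffKatoStratum` (item 19679), registered
# stub `stub_nonAdditive`, ROAD (b^k) ASSEMBLED: ALL semistable depth-`1` rows — any squarefree set `D` of extra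
# unramified primes — from the bare existence of the optimal-level newform (nothing else displayed)

Cell `bsd-addord`, seat `bsd-addord-w2-acc2`, gen 6; item `stmt-BirchSwinnertonDyer-19679` (`--supports`, closes
nothing). ROAD (b^k) file 5. The semistable depth-`1` rows of the stub have conductor `N = M₀·D·q` with `q` the
Tamagawa-`3` prime (split multiplicative, `3 ∣ ord_q Δ`), `D` the (squarefree, possibly empty) product of the OTHER
bad primes at which `ρ̄_{E,3}` is unramified/finite, and `M₀ = N(ρ̄)·3^δ` the optimal level. Gen 5 closed `D = 1`
(★★★′, 20 678 rows) and `D` prime (★★★★′, 8 107 rows); THIS FILE does every `D` at once (so also the 871 rows with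
`≥ 2` extra primes): the comparison form for Vatsal's congruence is `h = ι₁ G − β ι_q G` with `G` the `k`-fold
stabilisation of the level-`M₀` newform `g` (`…MultiStabData.exists_multiStab`: eigenform, normalised, integral,
number field, Condition 1, `a_p(G) = a_p(g)` off `D`, `a_p(G) ≡ a_p(f)` on `D`, real eigen-structure); Condition 1
for `h` is one more step of `…MultiStabConditionOne`; the period producer is `…MultiStabPeriod` (canonical period
of `Ψ = plusSymbol G` in the real structure) + `…MultiStabIhara` (THEOREM D″); then THEOREM A with producer
(`…DoubleStabData` §2) and gen 2's rekey consumer, exactly as in ★★★★ (`…DoubleStabRows`).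

★⁵ `stub_nonAdditive_semistable_squarefree_of_exists_levelLoweredNewform` — the registered stub's binders VERBATIM
(level `N`) + `Semistable W₀` + «ordinary if good at `3`» + `v₃(∏ c_ℓ) ≤ 1` + `M₀·D·q = N`, `q` split
multiplicative, `q ∤ M₀D`, `M₀D` squarefree + the EXISTENCE (for every `ι`) of a newform `g ∈ S₂(Γ₀(M₀))` with
`a_p(g) ≡ a_p(D₀.f)` (`p ∤ Dq`) and `a_p(g) ≡ a_p(D₀.f)(p + 1)` (`p ∣ Dq`) ⟹ the LOWER deep inequality of 19679,
from ELEVEN NAMED FACTS. Theorems only; nothing booked; BSD is not proved by any of this.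
-/

set_option autoImplicit false
-- the Theorems namespace of a single-conjunct summit repeats the summit name by design (D-0017)
set_option linter.dupNamespace false

noncomputable section

open scoped MatrixGroups ModularForm Classical NNReal

open CongruenceSubgroup WeierstrassCurve Literature.NumberTheory.EllipticCurves
  Literature.NumberTheory.EllipticCurves.ModularForms

namespace Summit.BirchSwinnertonDyer.BirchSwinnertonDyer.Theorems.KimAtThreeDeepLowerOffStratumLevelLoweringMultiStabRows

open Summit.BirchSwinnertonDyer.BirchSwinnertonDyer.Theorems.KimAtThreeDeepLowerOffStratumLevelLoweringVatsal
open Summit.BirchSwinnertonDyer.BirchSwinnertonDyer.Theorems.KimAtThreeDeepLowerOffStratumLevelLoweringVatsalRows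
open Summit.BirchSwinnertonDyer.BirchSwinnertonDyer.Theorems.KimAtThreeDeepLowerOffStratumLevelLoweringVatsalStab
open Summit.BirchSwinnertonDyer.BirchSwinnertonDyer.Theorems.KimAtThreeDeepLowerOffStratumLevelLoweringVatsalStabRows
open Summit.BirchSwinnertonDyer.BirchSwinnertonDyer.Theorems.KimAtThreeDeepLowerOffStratumLevelLoweringRekey
open Summit.BirchSwinnertonDyer.BirchSwinnertonDyer.Theorems.KimAtThreeDeepLowerOffStratumLevelLoweringConditionOne
open Summit.BirchSwinnertonDyer.BirchSwinnertonDyer.Theorems.KimAtThreeDeepLowerOffStratumLevelLoweringNonEisensteinPrime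
open Summit.BirchSwinnertonDyer.BirchSwinnertonDyer.Theorems.KimAtThreeDeepLowerOffStratumLevelLoweringRibetRows
open Summit.BirchSwinnertonDyer.BirchSwinnertonDyer.Theorems.KimAtThreeDeepLowerOffStratumLevelLoweringStabEigenform
  renaming heckeT_stab_of_ne → heckeT_stab_of_ne_eig, heckeT_stab_self → heckeT_stab_self_eig,
    isHeckeEigenform_stab → isHeckeEigenform_stab_eig, cuspCoeff_stab_prime → cuspCoeff_stab_prime_eig,
    cuspCoeff_mul_cuspCoeff → cuspCoeff_mul_cuspCoeff_eig, heckeEigenvalue_stab → heckeEigenvalue_stab_eig,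
    valuation_cuspCoeff_stab_le_one → valuation_cuspCoeff_stab_le_one_eig,
    finiteDimensional_coeffField_stab → finiteDimensional_coeffField_stab_eig
open Summit.BirchSwinnertonDyer.BirchSwinnertonDyer.Theorems.KimAtThreeDeepLowerOffStratumLevelLoweringStabEigenform (smul_plusSymbol_of_heckeT)
open Summit.BirchSwinnertonDyer.BirchSwinnertonDyer.Theorems.KimAtThreeDeepLowerOffStratumLevelLoweringDoubleStabData
open Summit.BirchSwinnertonDyer.BirchSwinnertonDyer.Theorems.KimAtThreeDeepLowerOffStratumLevelLoweringMultiStabConditionOne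
open Summit.BirchSwinnertonDyer.BirchSwinnertonDyer.Theorems.KimAtThreeDeepLowerOffStratumLevelLoweringMultiStabPeriod
open Summit.BirchSwinnertonDyer.BirchSwinnertonDyer.Theorems.KimAtThreeDeepLowerOffStratumLevelLoweringMultiStabIhara
open Summit.BirchSwinnertonDyer.BirchSwinnertonDyer.Theorems.KimAtThreeDeepLowerOffStratumLevelLoweringMultiStabData
open Literature.NumberTheory.EllipticCurves.Rank1Residual Literature.NumberTheory.EllipticCurves.Rank1Residual.Typed
  Literature.NumberTheory.EllipticCurves.Skinner2016 Literature.NumberTheory.Automorphic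

/-- ★⁵ **`stub_nonAdditive` (crux 19679) on ALL its SEMISTABLE depth-`1` rows — any squarefree product `D` of
extra unramified primes — from ELEVEN NAMED FACTS + the row conditions + the EXISTENCE of the optimal-level
newform** (level lowering at the squarefree set `Dq`, displayed). Inside: `G` = the `k`-fold stabilisation of
`g` at the primes of `D` (`exists_multiStab`); roots `β ≡ q` (`…ConditionOne`), `α ≠ β` (Coleman–Edixhoven);
`h = ι₁ G − β ι_q G` is a normalised eigenform at level `N` congruent to `D₀.f` in ALL coefficients
(`…StabEigenform`, `valuation_cuspCoeff_sub_lt_one_of_prime`); Condition 1 for `h` (`…MultiStabConditionOne`);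
the numeral `r₀ ≡ 1 (mod N)` by Chebotarev (`…NonEisensteinPrime`); Vatsal's congruence BY NAME with the period
produced afterwards (`…DoubleStabData` §2) from `…MultiStabPeriod` (canonical period of `Ψ = plusSymbol G` in
the real structure) and `…MultiStabIhara` (Ihara for `G`); gen 2's rekey consumer.
[cite: Vatsal1999, §1 (1.6), Thm. (1.13)] [cite: GreenbergVatsal2000, §3 (17)–(19)] [cite: Ribet1984ICM, Thm. 4.1]
[cite: ColemanEdixhoven1998, Thm. 2.1] [cite: TateGCFT1967, §2.4 (Tchebotarev density theorem) with Prop. 2.3]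
[cite: Skinner2016PacificMC, Thm. C (§1)] [cite: Mazur1978, Cor. 4.1] [cite: Kim2022StructureSelmer, Conj. 1.10 (PDF p. 8)] -/
theorem stub_nonAdditive_semistable_squarefree_of_exists_levelLoweredNewform
    (hCE : colemanEdixhoven1998_heckePolynomial_simpleRoots)
    (hV : vatsal1999_plusSymbol_congruence) (hGV : greenbergVatsal2000_plusSymbol_congruence)
    (hI : ribet1984_iharaLemma)
    (hSk : Skinner2016.thmC_padicValRat_bsd_rank_zero)
    (hmod : hasEntireLFunction_rat) (hGZK : rank_eq_analyticRank_of_analyticRank_le_one)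
    (hM : mazur_not_dvd_maninConstant_of_odd)
    (hBCDT : exists_isNewformOf) (hLL' : diamond1995_refinedSerre) :
    ∀ (W₀ : WeierstrassCurve ℚ) [W₀.IsElliptic] [W₀.IsGloballyMinimal],
      (∀ n : ℕ, W₀.HasSurjectiveModNGaloisRep (3 ^ n : ℕ)) → Finite W₀.sha →
      ∀ {N : ℕ} [NeZero N], N = W₀.conductorNorm ℤ →
      ∀ (D₀ : ModularParametrizationData W₀ N),
        (∀ z ∈ D₀.L.lattice, ∃ w ∈ periodLattice D₀.f, z = D₀.c * w) →
        (∀ (W₂ : WeierstrassCurve ℚ) [W₂.IsElliptic] (D₂ : ModularParametrizationData W₂ N),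
          D₂.f = D₀.f → D₀.modularDegree ≤ D₂.modularDegree) →
        (∀ r : ℚ, ratPlusSymbol D₀.f r ≠ 0 → 0 ≤ padicValRat 3 (ratPlusSymbol D₀.f r)) →
        kuriharaVanishingOrder W₀ 3 D₀.f = 0 →
        ¬ (haveI : Fact (Nat.Prime 3) := ⟨Nat.prime_three⟩; Addv W₀ 3) →
        Semistable W₀ →
        (W₀.HasGoodReductionAtPrime 3 → ¬ (3 : ℤ) ∣ W₀.frobeniusTrace 3) →
        padicValNat 3 W₀.tamagawaProduct ≤ 1 →
        ∀ {M₀ D q : ℕ} [NeZero M₀] [Fact q.Prime], M₀ * D * q = N →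
        W₀.HasSplitMultiplicativeReductionAtPrime q → ¬ q ∣ M₀ * D → Squarefree (M₀ * D) →
        (∀ p : ℕ, p.Prime → p ∣ D → ∃ u : ℤ, u * u = 1 ∧ cuspCoeff D₀.f p = u) →
        (∀ ι : PadicAlgCl 3 ≃+* ℂ, ∃ g : CuspForm (Gamma0 M₀) 2, IsNewform0 g ∧
          (∀ p : ℕ, p.Prime → ¬ p ∣ D * q → Valued.v (ι.symm (cuspCoeff D₀.f p - cuspCoeff g p)) < 1) ∧
          (∀ p : ℕ, p.Prime → p ∣ D * q → Valued.v (ι.symm (cuspCoeff g p - cuspCoeff D₀.f p * (p + 1))) < 1)) →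
        ∃ d : ℕ, kuriharaPartialDeepInfty W₀ 3 D₀.f = d ∧
          kuriharaPartial W₀ 3 D₀.f 0 ≤
            ((padicValNat 3 (Nat.card (AddCommGroup.primaryComponent W₀.sha 3)) + d : ℕ) : ℕ∞) := by
  intro W₀ _ _ htower hfin N _ hN D₀ hopt hdeg hint hord hnA hsst hordinary hv M₀ D q _ _ hMDq hsplit hqMD hMDsq hsign
    hex
  subst hMDq
  have hq : q.Prime := Fact.out
  haveI : NeZero q := ⟨hq.ne_zero⟩
  obtain ⟨hM₀D, -, hDsq⟩ := Nat.squarefree_mul_iff.mp hMDsq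
  haveI : NeZero D := ⟨Squarefree.ne_zero hDsq⟩
  have hqM₀ : ¬ q ∣ M₀ := fun h ↦ hqMD (h.mul_right D)
  have hqD : ¬ q ∣ D := fun h ↦ hqMD (h.mul_left M₀)
  set ι : PadicAlgCl 3 ≃+* ℂ := Classical.choice (PadicAlgCl.nonempty_ringEquiv_complex 3) with hι
  obtain ⟨g, hg, hcp, hrem⟩ := hex ι
  have hf := D₀.isNewformOf
  have hfq : cuspCoeff D₀.f q = 1 := by
    rw [hf.2 q, lFunction_eq_one_of_hasSplitMultiplicativeReductionAtPrime W₀ q hsplit, Int.cast_one]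
  -- the `k`-fold stabilisation `G` of `g` at the primes of `D` (level `M₀ D`)
  obtain ⟨G, hGeig, hGnorm, hGint, hGfd, hGC, hGg, hGf, hGspan⟩ :=
    exists_multiStab hg ι (fun p ↦ cuspCoeff D₀.f p) hCE D hDsq hM₀D.symm
      (fun p hp hpD ↦ by
        obtain ⟨u, hu, hfu⟩ := hsign p hp hpD
        refine ⟨u, hu, hfu, ?_⟩
        have h := hrem p hp (hpD.mul_right q)
        rwa [hfu] at h)
      (M₀ * D) rfl
  have hGp : ∀ {p : ℕ}, p.Prime → ¬ p ∣ M₀ * D → cuspCoeff G p = cuspCoeff g p :=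
    fun {p} hp hpL ↦ hGg p hp fun h ↦ hpL (h.mul_left M₀)
  -- the root `β ≡ q` at `q`, `α ≠ β` (Coleman–Edixhoven)
  have hGq : cuspCoeff G q = cuspCoeff g q := hGg q hq hqD
  have haq : Valued.v (ι.symm (cuspCoeff G q - (q + 1))) < 1 := by
    have h := hrem q hq (dvd_mul_left q D)
    rwa [hfq, one_mul, ← hGq] at h
  obtain ⟨β, hβ, hβq⟩ := exists_root_valuation_sub_lt_one ι (hGint q) q haq
  have hne : cuspCoeff G q - β ≠ β :=
    colemanEdixhoven1998_heckePolynomial_simpleRoots.root_ne hCE hg hq hqM₀ (by rw [← hGq]; exact sub_add_cancel _ β)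
      (by linear_combination -hβ)
  obtain ⟨hα1, hc⟩ := valuation_div_sub_one_lt_one ι hq hβ haq hβq
  -- the comparison form `h = ι₁ G − β ι_q G` at level `M₀ D q = N`
  have hq₁ : M₀ * D * 1 ∣ M₀ * D * q := mul_dvd_mul_left _ (one_dvd q)
  have hqq : M₀ * D * q ∣ M₀ * D * q := dvd_rfl
  set h := iota (M₀ * D) (M₀ * D * q) 1 2 hq₁ G - β • iota (M₀ * D) (M₀ * D * q) q 2 hqq G with hhdef
  have heig : IsHeckeEigenform h := isHeckeEigenform_stab_eig hGeig hGnorm β hq₁ hqq hq hqMD hβ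
  have hnorm : IsNormalized h := isNormalized_stab G β hq₁ hqq hGnorm hq
  have hhint : ∀ n, Valued.v (ι.symm (cuspCoeff h n)) ≤ 1 := valuation_cuspCoeff_stab_le_one_eig ι β hq₁ hqq hGint hβ
  have hhfd : FiniteDimensional ℚ (coeffField h) := finiteDimensional_coeffField_stab_eig β hq₁ hqq hGfd hβ
  have hhC : HasSimpleHeckeGenEigenspace h :=
    hasSimpleHeckeGenEigenspace_stab_of_hasSimpleHeckeGenEigenspace hg hq₁ hqq (dvd_mul_right M₀ D) hGeig hGnorm hGC
      (fun p hp hpL ↦ hGp hp hpL) hq hqMD hβ hne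
  have hfC : HasSimpleHeckeGenEigenspace D₀.f := hasSimpleHeckeGenEigenspace_of_isNewform0 hf.1
  -- congruence of ALL coefficients, from the primes
  have hcong : ∀ n : ℕ, Valued.v (ι.symm (cuspCoeff D₀.f n - cuspCoeff h n)) < 1 := by
    refine valuation_cuspCoeff_sub_lt_one_of_prime ι hf.1.2.1 heig hf.1.2.2 hnorm
      (valuation_cuspCoeff_le_one_of_isNewformOf W₀ hf ι) hhint fun p hp ↦ ?_
    rw [hhdef, cuspCoeff_stab_prime_eig hGnorm β hq₁ hqq hq hp]
    by_cases hpq : p = q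
    · subst hpq
      rw [if_pos rfl, hfq]
      have : ι.symm (1 - (cuspCoeff G p - β)) = -ι.symm (cuspCoeff G p - β - 1) := by rw [← map_neg]; congr 1; ring
      rw [this, Valuation.map_neg]; exact hα1
    · rw [if_neg hpq]
      by_cases hpD : p ∣ D
      · exact hGf p hp hpD
      · have hpDq : ¬ p ∣ D * q := fun h' ↦ by
          rcases (Nat.Prime.dvd_mul hp).mp h' with h' | h'
          · exact hpD h'
          · exact hpq ((Nat.prime_dvd_prime_iff_eq hp hq).mp h')
        rw [hGg p hp hpD]; exact hcp p hp hpDq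
  -- the OLD SHAPE data `(Φ, c, b) = (plusSymbol G, β/q, a_·(g))`
  have hshape : ∀ x : ℚ, plusSymbol h x = plusSymbol G x - β / q * plusSymbol G (q * x) :=
    fun x ↦ plusSymbol_stab G β hq₁ hqq x
  have hΦper : ∀ x : ℚ, plusSymbol G (x + 1) = plusSymbol G x := by
    intro x
    have e₁ := modularSymbol_add_intCast_holds G x 1
    have e₂ := modularSymbol_add_intCast_holds G (-x) (-1)
    simp only [plusSymbol]
    rw [show -(x + 1) = -x + ((-1 : ℤ) : ℚ) by push_cast; ring, e₂, show x + 1 = x + ((1 : ℤ) : ℚ) by push_cast; ring, e₁]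
  have hb : ∀ p : ℕ, p.Prime → ¬ p ∣ W₀.conductorNorm ℤ * 3 →
      Valued.v (ι.symm (cuspCoeff g p - (W₀.frobeniusTrace p : ℂ))) < 1 := by
    intro p hp hpN3
    haveI : Fact p.Prime := ⟨hp⟩
    have hpN : ¬ p ∣ W₀.conductorNorm ℤ := fun h' ↦ hpN3 (h'.mul_right 3)
    have hpDq : ¬ p ∣ D * q := fun h' ↦ hpN (hN ▸ (mul_assoc M₀ D q).symm ▸ h'.mul_left M₀)
    have hfp : cuspCoeff D₀.f p = (W₀.frobeniusTrace p : ℂ) := by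
      rw [hf.2 p, LFunction_apply_prime_eq_frobeniusTrace W₀ p (hasGoodReductionAtPrime_of_not_dvd_conductorNorm W₀ hpN)]
    rw [← hfp, ← Valuation.map_neg, ← map_neg, neg_sub]
    exact hcp p hp hpDq
  have hTG : ∀ (p : ℕ) (hp : p.Prime), ¬ p ∣ M₀ * D →
      (haveI : NeZero p := ⟨hp.ne_zero⟩; heckeT (Gamma0 (M₀ * D)) 2 p G) = cuspCoeff g p • G := by
    intro p hp hpL
    haveI : NeZero p := ⟨hp.ne_zero⟩
    rw [heckeT_eq_heckeEigenvalue_smul G p (hGeig p hp), heckeEigenvalue_eq_coeff_of_isNormalized hGnorm hp (hGeig p hp),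
      ← hGp hp hpL]
    rfl
  have hΦhecke : ∀ p : ℕ, p.Prime → ¬ p ∣ W₀.conductorNorm ℤ * 3 → ∀ x : ℚ,
      cuspCoeff g p * plusSymbol G x = (∑ j : Fin p, plusSymbol G ((x + j) / p)) + plusSymbol G (p * x) := by
    intro p hp hpN3 x
    haveI : NeZero p := ⟨hp.ne_zero⟩
    have hpL : ¬ p ∣ M₀ * D := fun h' ↦ hpN3 ((hN ▸ h'.mul_right q).mul_right 3)
    exact smul_plusSymbol_of_heckeT p hp hpL (hTG p hp hpL) x
  -- the numeral `r₀ ≡ 1 (mod N)` by Chebotarev, and the unit `a_{r₀}(g) − r₀ − 1`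
  have hsurj : W₀.HasSurjectiveModNGaloisRep ((3 : ℕ) : ℤ) := by simpa only [pow_one] using htower 1
  obtain ⟨r₀, hr₀, -, hr₀S, -, hr₀1, hE₀⟩ := exists_prime_one_mod_not_dvd_frobeniusTrace_sub W₀ hsurj (M₀ * D * q)
  haveI : Fact r₀.Prime := ⟨hr₀⟩
  have hr₀L : ¬ r₀ ∣ M₀ * D := fun h' ↦ hr₀S (h'.mul_right q)
  have hr₀Dq : ¬ r₀ ∣ D * q := fun h' ↦ hr₀S ((mul_assoc M₀ D q).symm ▸ h'.mul_left M₀)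
  have hr₀N : ¬ r₀ ∣ W₀.conductorNorm ℤ := by rwa [← hN]
  have hfr₀ : cuspCoeff D₀.f r₀ = (W₀.frobeniusTrace r₀ : ℂ) := by
    rw [hf.2 r₀, LFunction_apply_prime_eq_frobeniusTrace W₀ r₀ (hasGoodReductionAtPrime_of_not_dvd_conductorNorm W₀ hr₀N)]
  have hunit : Valued.v (ι.symm (cuspCoeff g r₀ - (r₀ + 1))) = 1 := by
    refine valuation_cuspCoeff_sub_eq_one_of_congr ι hE₀ ?_
    rw [← hfr₀]; exact hcp r₀ hr₀ hr₀Dq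
  -- the real structure of `G`: `G = Σ cᵢ φᵢ`, `φᵢ` real with `T_r φᵢ = a_r(g) φᵢ` (`r ∤ M₀D`)
  obtain ⟨n, c, φ, hGsum⟩ := Submodule.mem_span_set'.mp hGspan
  have hreal : ∀ i m, (cuspCoeff (φ i : CuspForm (Gamma0 (M₀ * D)) 2) m).im = 0 := fun i ↦ (φ i).2.1
  have hφT : ∀ (i : Fin n) (r : ℕ) (hr : r.Prime), ¬ r ∣ M₀ * D * q →
      (haveI : NeZero r := ⟨hr.ne_zero⟩; heckeT (Gamma0 (M₀ * D)) 2 r (φ i : CuspForm (Gamma0 (M₀ * D)) 2)) =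
        cuspCoeff g r • (φ i : CuspForm (Gamma0 (M₀ * D)) 2) :=
    fun i r hr hrS ↦ (φ i).2.2 r hr fun h' ↦ hrS (h'.mul_right q)
  have he : ∀ r : ℕ, r.Prime → ¬ r ∣ M₀ * D * q → IsIntegral ℤ (cuspCoeff g r) ∧ (cuspCoeff g r).im = 0 :=
    fun r _ _ ↦ ⟨IsNewform0.isIntegral_coeff_holds hg r, hg.cuspCoeff_im_eq_zero r⟩
  -- the period producer: `plusSymbol h ≢ 0 ⟹ Ψ ≢ 0 ⟹ Ω (canonical period of Ψ) ⟹ x₀ (Ihara)`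
  have hΩ : (∃ x : ℚ, plusSymbol h x ≠ 0) →
      ∃ Ω : ℂ, (∀ x : ℚ, Valued.v (ι.symm (plusSymbol G x / Ω)) ≤ 1) ∧
        ∃ x₀ : ℚ, Valued.v (ι.symm ((plusSymbol G x₀ - β / q * plusSymbol G (q * x₀)) / Ω)) = 1 := by
    rintro ⟨x, hx⟩
    have hne0 : ∃ y : ℚ, plusSymbol (∑ i, c i • (φ i : CuspForm (Gamma0 (M₀ * D)) 2)) y ≠ 0 := by
      by_contra hall
      push Not at hall
      rw [hGsum] at hall
      exact hx (by rw [hshape, hall, hall, mul_zero, sub_zero])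
    have hTsum := hTG r₀ hr₀ hr₀L
    rw [← hGsum] at hTsum
    obtain ⟨Ω, hΩint, γ₀, hγ₀, hΩu⟩ := exists_period_integral_unit_cycle_sum_smul (c := c) ι hMDsq hreal hne0 hr₀ hr₀L
      (valuation_cuspCoeff_le_one_of_isNewform0 hg ι r₀) hTsum hunit
    obtain ⟨x₀, hx₀⟩ := exists_valuation_stabilisedSymbol_eq_one_sum_smul_of_ribet1984_iharaLemma hI hq hqMD hφT he hreal
      c ι hΩint γ₀ hγ₀ hΩu hr₀ hr₀S hr₀1 hunit hc
    rw [hGsum] at hΩint hx₀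
    exact ⟨Ω, hΩint, x₀, hx₀⟩
  -- THEOREM A (with producer), then gen 2's rekey consumer
  obtain ⟨π, hLL⟩ := isStabilisedLevelLoweringCongruenceIn_three_of_not_addv_of_exists_period hV hGV W₀ htower hN D₀
    hint hnA ι h q hfC heig hnorm hhfd hhint hhC hcong (plusSymbol G) (β / q) (fun p ↦ cuspCoeff g p) hshape hc hΦper hb
    hΦhecke hΩ
  exact stub_nonAdditive_semistable_of_isStabilisedLevelLoweringCongruenceIn hSk hmod hGZK hM hBCDT hLL' W₀ htower hfin
    hN D₀ hopt hdeg hint hord hnA hsst hordinary hv π q (hN ▸ dvd_mul_left q _) hLL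

end Summit.BirchSwinnertonDyer.BirchSwinnertonDyer.Theorems.KimAtThreeDeepLowerOffStratumLevelLoweringMultiStabRows

end
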